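import Literature.Probability.LatticeModels.RandomClusterEdgeWeightsConditioning
import HarnessLib

/-!
# FK-continuity transplant, FT-05 (i): history-conditioned random-cluster laws `φ^B_{condWeights w F ξ, q}` —
# the algebra of the conditional parameters, support, and monotonicity in the history

Cell `fk-continuity` (bschramm), FRONTIER TRANSPLANT sub-cell, registry row FT-05 (`KNFreePinning`); support file
(`--supports stmt-CriticalPhenomena-4575`); builds on p205010 (kernel theorem, internal audit signed; external
expert review pending). HONEST FRAMING: the transplant `ufsc0_of_freeBoundaryHypothesis_r0` this file serves is
CONDITIONAL on the free-boundary penetration hypothesis FH (open at the same `p` for `q > 1`; ⇔ GRC Conj. (5.103)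
via the referee's calibration K1; barrier note `SamePFreeBoundaryCriteria`, Literature/Barriers/CriticalPhenomena);
it is a typed reduction, not a proof of FK continuity. THIS file is unconditional finite-volume measure theory:
no named facts, no sorries, standard axioms; nothing here is specific to `q = 2` or to `d = 3`.

## What is here (the FK replacement of `pinW`, part i of three)

Kozma–Nitzan (arXiv:2401.12397, §4) condition Bernoulli percolation on the revealed states of finitely many edges
(eq. (30) p. 27: `P(0 ↔ M_x | ω|_D) > 1 - δ`); at `q = 1` the conditional law is again a product measure
(`prodBernoulli (pinW w F ξ)`, `Literature/Probability/Percolation/KozmaNitzanPinning.lean`). For the random-cluster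
measure `φ^B_{𝐩,q} = rcMeasureW w q B` of a finite vertex type (Grimmett 2006, eq. (1.20);
`RandomClusterEdgeWeights.lean`) the conditional law given the states of the edges off a region `F` is again a
measure of the same kind, `rcMeasureW (condWeights w F ξ) q B` (Grimmett 2006, Thm. (3.7) / Lemma (4.13), tree
`rcMeasureW_real_inter_cylinder`): the edges of `F` keep their parameters, the revealed-open edges `ξ` get
parameter `1` (they act as the boundary condition: every revealed cluster is wired into itself), every other edge
gets parameter `0` (deleted). This is the "per-direction law `P_{R,h}`" of the transplant design (REFUTER-REPORT §8
F4: "fresh edges of `R`, all revealed-open edges kept and wired into their clusters, every other edge deleted").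

We prove, for general `w`, `q`, `B`:

* §1 the algebra of `condWeights`: evaluation, normal form `condWeights w F (ξ ∖ F) = condWeights w F ξ`, ITERATION
  `condWeights (condWeights w F ξ) F' ξ' = condWeights w (F ∩ F') ((ξ' ∖ F') ∪ (ξ ∩ F'))` (successive conditioning,
  KN p. 27/p. 30), and the pointwise COMPARISON `condWeights w F ξ ≤ condWeights w F' ξ'` under three edgewise
  conditions, with its corollaries "more revealed-open edges", "larger fresh region" (F4 (c), region/history
  monotonicity);
* §2 support: the conditioned law is carried by the cylinder `{ω ∖ F = ξ}` (`rcMeasureW_condWeights_real_cylinder`),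
  so events agreeing on the cylinder have the same probability;
* §4 MONOTONICITY in the history for increasing events (Grimmett 2006, Thm. (3.21) edge by edge; Lemma (4.14)(b)):
  `rcMeasureW_condWeights_real_mono`, the decreasing-event transfer `…_real_anti_of_isLowerSet` (F4 (b)), history
  and region monotonicity, FKG of every conditioned law.

Companions: (ii) `KNFreePinningDomainMarkov.lean` (§3: domain Markov in revealed-set form, total probability over
patterns, transfer of uniform conditional bounds), (iii) `KNFreePinningWorstCase.lean` (§5: the fresh region alone
with the seed wired is the worst case, Lemma (4.14)(b) lower half), and `KNFreePinningBadEvents.lean` (KN's events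
`B_j`).

## References

* G. Grimmett, *The Random-Cluster Model*, Springer 2006: eq. (1.20) p. 15; Thm. (2.1) (Holley); Thm. (3.1)(a),
  Thm. (3.7) p. 39; Thm. (3.8), eq. (3.12); Thm. (3.21)–(3.22); §4.2 (4.11)–(4.13), Lemma (4.13) p. 71,
  Lemma (4.14)(b) p. 72. [Grimmett2006]
* G. Kozma, S. Nitzan, arXiv:2401.12397 (2024), §4: p. 20 (total probability over `ξ`), p. 22, p. 27 eq. (30),
  pp. 30–31 (events `B_j`, (36)–(37)). [KozmaNitzan2024]
* R. Holley, Comm. Math. Phys. 36 (1974) 227–231; Mathlib `Mathlib.Combinatorics.SetFamily.FourFunctions`.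
-/

noncomputable section

open MeasureTheory Finset SimpleGraph
open scoped ENNReal Classical

namespace Summit.CriticalPhenomena.PercolationContinuityZ3.Theorems.FK

open Literature.Probability.Percolation (BondConfig openGraph localCylinder DeterminedBy determinedBy_iff)
open Literature.Probability.LatticeModels
open Literature.Probability.Percolation.BHK2006 (weight weight_nonneg ind_inter)
open Literature.Probability.Percolation.DecisionTree (ind ind_of_mem ind_of_not_mem ind_nonneg)

/-! ## §1 The algebra of conditional weights -/

section Algebra

variable {V : Type*} (w : Sym2 V → unitInterval)

/-- Unfolding of `condWeights`. [cite: Grimmett2006, Thm. (3.7) (p. 39)] -/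
theorem condWeights_apply (F ξ : Set (Sym2 V)) (e : Sym2 V) :
    condWeights w F ξ e = if e ∈ F then w e else if e ∈ ξ then 1 else 0 := rfl

/-- On the fresh region the parameters are unchanged. [cite: Grimmett2006, Thm. (3.7) (p. 39)] -/
theorem condWeights_of_mem {F : Set (Sym2 V)} (ξ : Set (Sym2 V)) {e : Sym2 V} (he : e ∈ F) :
    condWeights w F ξ e = w e := by
  simp [condWeights_apply, he]

/-- A revealed-open edge gets parameter `1`. [cite: Grimmett2006, Thm. (3.7) (p. 39)] -/
theorem condWeights_of_not_mem_of_mem {F ξ : Set (Sym2 V)} {e : Sym2 V} (he : e ∉ F) (hξ : e ∈ ξ) :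
    condWeights w F ξ e = 1 := by
  simp [condWeights_apply, he, hξ]

/-- A revealed-closed edge (off `F` and off `ξ`) gets parameter `0`: it is deleted.
[cite: Grimmett2006, Thm. (3.7) (p. 39)] -/
theorem condWeights_of_not_mem_of_not_mem {F ξ : Set (Sym2 V)} {e : Sym2 V} (he : e ∉ F) (hξ : e ∉ ξ) :
    condWeights w F ξ e = 0 := by
  simp [condWeights_apply, he, hξ]

/-- The conditional parameters as real numbers. [cite: Grimmett2006, Thm. (3.7) (p. 39)] -/
theorem coe_condWeights_apply (F ξ : Set (Sym2 V)) (e : Sym2 V) :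
    ((condWeights w F ξ e : unitInterval) : ℝ) = if e ∈ F then (w e : ℝ) else if e ∈ ξ then 1 else 0 := by
  rw [condWeights_apply]
  split_ifs <;> simp

/-- The conditional parameters depend on `ξ` only through `ξ ∖ F`. [cite: Grimmett2006, Thm. (3.7) (p. 39)] -/
theorem condWeights_congr {F ξ ξ' : Set (Sym2 V)} (h : ∀ e, e ∉ F → (e ∈ ξ ↔ e ∈ ξ')) :
    condWeights w F ξ = condWeights w F ξ' := by
  funext e
  by_cases he : e ∈ F
  · simp [condWeights_apply, he]
  · simp [condWeights_apply, he, h e he]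

/-- Normal form: `condWeights w F (ξ ∖ F) = condWeights w F ξ`. [cite: Grimmett2006, Thm. (3.7) (p. 39)] -/
theorem condWeights_sdiff (F ξ : Set (Sym2 V)) : condWeights w F (ξ \ F) = condWeights w F ξ :=
  condWeights_congr w fun _ he => ⟨fun h => h.1, fun h => ⟨h, he⟩⟩

/-- Conditioning on nothing: `condWeights w univ ξ = w`. [cite: Grimmett2006, Thm. (3.7) (p. 39)] -/
theorem condWeights_univ (ξ : Set (Sym2 V)) : condWeights w Set.univ ξ = w := by
  funext e
  simp [condWeights_apply]

/-- **Iterated conditioning** (Kozma–Nitzan 2024, p. 27 and p. 30: condition on `ω|_{E_i}`, then on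
`ω|_{E_{w,v} ∪ H^j}`): conditioning the conditioned parameters again is a single conditioning, with fresh region
`F ∩ F'` and revealed-open set `(ξ' ∖ F') ∪ (ξ ∩ F')`. [cite: KozmaNitzan2024, §4 pp. 27–30] -/
theorem condWeights_condWeights (F ξ F' ξ' : Set (Sym2 V)) :
    condWeights (condWeights w F ξ) F' ξ' = condWeights w (F ∩ F') ((ξ' \ F') ∪ (ξ ∩ F')) := by
  funext e
  by_cases heF : e ∈ F <;> by_cases heF' : e ∈ F' <;> by_cases heξ : e ∈ ξ <;> by_cases heξ' : e ∈ ξ' <;>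
    simp [condWeights_apply, heF, heF', heξ, heξ']

/-- Iterated conditioning, nested form: if the new fresh region `F'` lies inside the old one and no revealed-open
edge of the first conditioning is fresh, then `condWeights (condWeights w F ξ) F' ξ' = condWeights w F' ξ'` — valid
as an identity of parameters for EVERY `ξ'`; the corresponding conditioning event is null unless `ξ ⊆ ξ'`
(`rcMeasureW_condWeights_real_cylinder`). [cite: KozmaNitzan2024, §4 pp. 27–30] -/
theorem condWeights_condWeights_of_subset {F ξ F' : Set (Sym2 V)} (hF : F' ⊆ F) (hξ : Disjoint ξ F)
    (ξ' : Set (Sym2 V)) : condWeights (condWeights w F ξ) F' ξ' = condWeights w F' ξ' := by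
  rw [condWeights_condWeights, Set.inter_eq_right.2 hF]
  have h0 : ξ ∩ F' = ∅ := Set.disjoint_iff_inter_eq_empty.1 (hξ.mono_right hF)
  rw [h0, Set.union_empty, condWeights_sdiff]

/-- **Pointwise comparison of conditional parameters.** `condWeights w F ξ ≤ condWeights w F' ξ'` as soon as
(i) every old fresh edge that is no longer fresh is revealed open, (ii) no old revealed-open edge becomes fresh, and
(iii) old revealed-open edges stay revealed open. (Grimmett 2006, Thm. (3.21): comparison is then edge by edge.)
[cite: Grimmett2006, Thm. (3.21), eq. (3.22)] -/
theorem condWeights_le_condWeights {F ξ F' ξ' : Set (Sym2 V)} (h₁ : ∀ e ∈ F, e ∉ F' → e ∈ ξ')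
    (h₂ : ∀ e ∈ ξ, e ∉ F → e ∉ F') (h₃ : ∀ e ∈ ξ, e ∉ F → e ∈ ξ') :
    condWeights w F ξ ≤ condWeights w F' ξ' := by
  intro e
  by_cases heF : e ∈ F
  · by_cases heF' : e ∈ F'
    · rw [condWeights_of_mem w ξ heF, condWeights_of_mem w ξ' heF']
    · rw [condWeights_of_mem w ξ heF, condWeights_of_not_mem_of_mem w heF' (h₁ e heF heF')]
      exact unitInterval.le_one'
  · by_cases heξ : e ∈ ξ
    · rw [condWeights_of_not_mem_of_mem w heF heξ,
        condWeights_of_not_mem_of_mem w (h₂ e heξ heF) (h₃ e heξ heF)]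
    · rw [condWeights_of_not_mem_of_not_mem w heF heξ]
      exact unitInterval.nonneg'

/-- **History monotonicity**: more revealed-open edges give larger parameters (same fresh region).
[cite: Grimmett2006, Lemma (4.14)(b) (p. 72)] -/
theorem condWeights_mono_right (F : Set (Sym2 V)) {ξ ξ' : Set (Sym2 V)} (h : ξ ⊆ ξ') :
    condWeights w F ξ ≤ condWeights w F ξ' :=
  condWeights_le_condWeights w (fun _ he hne => (hne he).elim) (fun _ _ he => he) fun _ he _ => h he

/-- **Region monotonicity**: enlarging the fresh region by previously DELETED edges gives larger parameters
(same revealed-open set): `F ⊆ F'`, no revealed-open edge off `F` lies in `F'`.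
[cite: Grimmett2006, Lemma (4.14)(b) (p. 72)] -/
theorem condWeights_mono_left {F F' : Set (Sym2 V)} (hF : F ⊆ F') (ξ : Set (Sym2 V))
    (hξ : ∀ e ∈ ξ, e ∉ F → e ∉ F') : condWeights w F ξ ≤ condWeights w F' ξ :=
  condWeights_le_condWeights w (fun _ he hne => (hne (hF he)).elim) hξ fun _ he _ => he

/-- Region monotonicity, disjoint form: for `F ⊆ F'` and `ξ` disjoint from `F'`,
`condWeights w F ξ ≤ condWeights w F' ξ` (the law on a sub-region of the fresh region, everything else of the fresh
region deleted, lies below the full fresh law: REFUTER-REPORT F4 (b), `P^x ≤_st` the true conditional law).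
[cite: Grimmett2006, Lemma (4.14)(b) (p. 72)] -/
theorem condWeights_mono_left_of_disjoint {F F' : Set (Sym2 V)} (hF : F ⊆ F') {ξ : Set (Sym2 V)}
    (hξ : Disjoint ξ F') : condWeights w F ξ ≤ condWeights w F' ξ :=
  condWeights_mono_left w hF ξ fun _ he _ he' => Set.disjoint_left.1 hξ he he'

/-- Opening fresh edges raises the parameters: for `F' ⊆ F`, `condWeights w F ξ ≤ condWeights w F' (ξ ∪ (F ∖ F'))`.
[cite: Grimmett2006, Lemma (4.14)(b) (p. 72)] -/
theorem condWeights_le_condWeights_union_sdiff {F F' : Set (Sym2 V)} (hF : F' ⊆ F) (ξ : Set (Sym2 V)) :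
    condWeights w F ξ ≤ condWeights w F' (ξ ∪ (F \ F')) :=
  condWeights_le_condWeights w (fun _ he hne => Or.inr ⟨he, hne⟩) (fun _ _ he he' => he (hF he'))
    fun _ he _ => Or.inl he

end Algebra

/-! ## §2 The conditioned law lives on its cylinder -/

section Support

variable {V : Type*} [Fintype V] (w : Sym2 V → unitInterval)

/-- The off-region weight of the conditional parameters along their own revealed set is `1`.
[cite: Grimmett2006, Thm. (3.7) (p. 39)] -/
theorem offWeight_condWeights (F ξ : Set (Sym2 V)) : offWeight (condWeights w F ξ) F ξ = 1 := by
  unfold offWeight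
  refine Finset.prod_eq_one fun e _ => ?_
  by_cases heF : e ∈ F
  · simp [heF]
  · by_cases heξ : e ∈ ξ
    · simp [heF, heξ, coe_condWeights_apply]
    · simp [heF, heξ, coe_condWeights_apply]

/-- **The conditional weight vanishes off the cylinder `{ω ∖ F = ξ}`** (`ξ` disjoint from `F`): a configuration
that opens a deleted edge or closes a revealed-open one has weight `0`. [cite: Grimmett2006, Thm. (3.7) (p. 39)] -/
theorem rcWeightW_condWeights_eq_zero (q : ℝ) (B : Set V) {F ξ : Set (Sym2 V)} (hξ : Disjoint ξ F)
    {ω : BondConfig V} (hω : ω \ F ≠ ξ) : rcWeightW (condWeights w F ξ) q B ω = 0 := by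
  have key := rcWeightW_mul_ind_cylinder (condWeights w F ξ) q B hξ ω
  rw [condWeights_condWeights_of_subset w subset_rfl hξ, offWeight_condWeights, one_mul,
    ind_of_not_mem (show ω ∉ {ω : BondConfig V | ω \ F = ξ} from hω), mul_zero] at key
  exact key.symm

/-- The conditioned law gives probability `0` to the complement of its cylinder.
[cite: Grimmett2006, Thm. (3.7) (p. 39)] -/
theorem rcMeasureW_condWeights_real_cylinder_compl {q : ℝ} (hq : 0 < q) (B : Set V) {F ξ : Set (Sym2 V)}
    (hξ : Disjoint ξ F) :
    (rcMeasureW (condWeights w F ξ) q B).real {ω : BondConfig V | ω \ F = ξ}ᶜ = 0 := by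
  rw [rcMeasureW_real_eq_sum_div _ hq]
  rw [Finset.sum_eq_zero, zero_div]
  intro ω _
  by_cases hω : ω \ F = ξ
  · rw [ind_of_not_mem (show ω ∉ ({ω : BondConfig V | ω \ F = ξ}ᶜ) from fun h => h hω), mul_zero]
  · rw [rcWeightW_condWeights_eq_zero w q B hξ hω, zero_mul]

/-- The conditioned law gives measure `0` to the complement of its cylinder (`ℝ≥0∞` form).
[cite: Grimmett2006, Thm. (3.7) (p. 39)] -/
theorem rcMeasureW_condWeights_cylinder_compl {q : ℝ} (hq : 0 < q) (B : Set V) {F ξ : Set (Sym2 V)}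
    (hξ : Disjoint ξ F) :
    rcMeasureW (condWeights w F ξ) q B {ω : BondConfig V | ω \ F = ξ}ᶜ = 0 := by
  haveI := isProbabilityMeasure_rcMeasureW (condWeights w F ξ) hq B
  exact (measureReal_eq_zero_iff (measure_ne_top _ _)).1 (rcMeasureW_condWeights_real_cylinder_compl w hq B hξ)

/-- Intersecting with the cylinder does not change probabilities under the conditioned law.
[cite: Grimmett2006, Thm. (3.7) (p. 39)] -/
theorem rcMeasureW_condWeights_real_inter_cylinder_self {q : ℝ} (hq : 0 < q) (B : Set V)
    {F ξ : Set (Sym2 V)} (hξ : Disjoint ξ F) (A : Set (BondConfig V)) :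
    (rcMeasureW (condWeights w F ξ) q B).real (A ∩ {ω : BondConfig V | ω \ F = ξ}) =
      (rcMeasureW (condWeights w F ξ) q B).real A := by
  simp only [measureReal_def]
  rw [measure_inter_conull (rcMeasureW_condWeights_cylinder_compl w hq B hξ)]

/-- **The conditioned law is carried by its cylinder**: `φ_{condWeights w F ξ}({ω ∖ F = ξ}) = 1`.
[cite: Grimmett2006, Thm. (3.7) (p. 39)] -/
theorem rcMeasureW_condWeights_real_cylinder {q : ℝ} (hq : 0 < q) (B : Set V) {F ξ : Set (Sym2 V)}
    (hξ : Disjoint ξ F) :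
    (rcMeasureW (condWeights w F ξ) q B).real {ω : BondConfig V | ω \ F = ξ} = 1 := by
  haveI := isProbabilityMeasure_rcMeasureW (condWeights w F ξ) hq B
  rw [← Set.univ_inter {ω : BondConfig V | ω \ F = ξ}, rcMeasureW_condWeights_real_inter_cylinder_self w hq B hξ,
    probReal_univ]

/-- **Events agreeing on the cylinder have the same conditional probability** (how an event of the full
configuration is read as an event of the fresh configuration and back). [cite: Grimmett2006, Thm. (3.7) (p. 39)] -/
theorem rcMeasureW_condWeights_real_congr {q : ℝ} (hq : 0 < q) (B : Set V) {F ξ : Set (Sym2 V)}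
    (hξ : Disjoint ξ F) {A A' : Set (BondConfig V)} (h : ∀ ω : BondConfig V, ω \ F = ξ → (ω ∈ A ↔ ω ∈ A')) :
    (rcMeasureW (condWeights w F ξ) q B).real A = (rcMeasureW (condWeights w F ξ) q B).real A' := by
  rw [← rcMeasureW_condWeights_real_inter_cylinder_self w hq B hξ A,
    ← rcMeasureW_condWeights_real_inter_cylinder_self w hq B hξ A']
  congr 1
  ext ω
  simp only [Set.mem_inter_iff, Set.mem_setOf_eq]
  constructor
  · rintro ⟨hA, hω⟩; exact ⟨(h ω hω).1 hA, hω⟩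
  · rintro ⟨hA, hω⟩; exact ⟨(h ω hω).2 hA, hω⟩

end Support

/-! ## §4 Monotonicity in the history (comparison between boundary conditions) -/

section Monotonicity

variable {V : Type*} [Fintype V] (w : Sym2 V → unitInterval)

/-- For decreasing events the comparison in the parameters reverses: `w ≤ w'` pointwise and `q ≥ 1` give
`φ^B_{w',q}(D) ≤ φ^B_{w,q}(D)` for every decreasing `D`. [cite: Grimmett2006, Thm. (3.21), eq. (3.22)] -/
theorem rcMeasureW_real_anti_weights_of_isLowerSet {w w' : Sym2 V → unitInterval} (hww : ∀ e, w e ≤ w' e)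
    {q : ℝ} (hq : 1 ≤ q) (B : Set V) {D : Set (BondConfig V)} (hD : IsLowerSet D) :
    (rcMeasureW w' q B).real D ≤ (rcMeasureW w q B).real D := by
  have hq0 : 0 < q := one_pos.trans_le hq
  haveI := isProbabilityMeasure_rcMeasureW w hq0 B
  haveI := isProbabilityMeasure_rcMeasureW w' hq0 B
  have h := rcMeasureW_real_mono_weights hww hq B hD.compl
  rw [probReal_compl_eq_one_sub (Set.toFinite D).measurableSet,
    probReal_compl_eq_one_sub (Set.toFinite D).measurableSet] at h
  linarith

/-- **Comparison of history-conditioned laws, increasing events** (Grimmett 2006, Lemma (4.14)(b): `φ^ξ_Λ` is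
increasing in the boundary condition `ξ`; here through Thm. (3.21) edge by edge): under the three edgewise
conditions of `condWeights_le_condWeights`, `φ^B_{condWeights w F ξ, q}(A) ≤ φ^B_{condWeights w F' ξ', q}(A)` for
every increasing `A`, `q ≥ 1`. [cite: Grimmett2006, Lemma (4.14)(b) (p. 72); Thm. (3.21)] -/
theorem rcMeasureW_condWeights_real_mono {q : ℝ} (hq : 1 ≤ q) (B : Set V) {F ξ F' ξ' : Set (Sym2 V)}
    (h₁ : ∀ e ∈ F, e ∉ F' → e ∈ ξ') (h₂ : ∀ e ∈ ξ, e ∉ F → e ∉ F') (h₃ : ∀ e ∈ ξ, e ∉ F → e ∈ ξ')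
    {A : Set (BondConfig V)} (hA : IsUpperSet A) :
    (rcMeasureW (condWeights w F ξ) q B).real A ≤ (rcMeasureW (condWeights w F' ξ') q B).real A :=
  rcMeasureW_real_mono_weights (condWeights_le_condWeights w h₁ h₂ h₃) hq B hA

/-- **Decreasing-event transfer** (REFUTER-REPORT §8 F4 (b): `P_true(v bad | h) ≤ P^x(v bad)` by ONE domination):
under the same three conditions, `φ^B_{condWeights w F' ξ', q}(D) ≤ φ^B_{condWeights w F ξ, q}(D)` for every
decreasing `D`, `q ≥ 1`. [cite: Grimmett2006, Lemma (4.14)(b) (p. 72); Thm. (3.21)] -/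
theorem rcMeasureW_condWeights_real_anti_of_isLowerSet {q : ℝ} (hq : 1 ≤ q) (B : Set V)
    {F ξ F' ξ' : Set (Sym2 V)} (h₁ : ∀ e ∈ F, e ∉ F' → e ∈ ξ') (h₂ : ∀ e ∈ ξ, e ∉ F → e ∉ F')
    (h₃ : ∀ e ∈ ξ, e ∉ F → e ∈ ξ') {D : Set (BondConfig V)} (hD : IsLowerSet D) :
    (rcMeasureW (condWeights w F' ξ') q B).real D ≤ (rcMeasureW (condWeights w F ξ) q B).real D :=
  rcMeasureW_real_anti_weights_of_isLowerSet (condWeights_le_condWeights w h₁ h₂ h₃) hq B hD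

/-- **History monotonicity**: with the same fresh region, more revealed-open edges raise the probability of
every increasing event (`q ≥ 1`). [cite: Grimmett2006, Lemma (4.14)(b) (p. 72)] -/
theorem rcMeasureW_condWeights_real_mono_right {q : ℝ} (hq : 1 ≤ q) (B : Set V) (F : Set (Sym2 V))
    {ξ ξ' : Set (Sym2 V)} (hξ : ξ ⊆ ξ') {A : Set (BondConfig V)} (hA : IsUpperSet A) :
    (rcMeasureW (condWeights w F ξ) q B).real A ≤ (rcMeasureW (condWeights w F ξ') q B).real A :=
  rcMeasureW_real_mono_weights (condWeights_mono_right w F hξ) hq B hA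

/-- **Region monotonicity**: with the same revealed-open set `ξ` (disjoint from `F'`), enlarging the fresh region
`F ⊆ F'` (the extra edges were deleted before) raises the probability of every increasing event (`q ≥ 1`). In
particular the per-direction law on a sub-region of the fresh region lies below the true conditional law
(REFUTER-REPORT §8 F4 (b), (c)). [cite: Grimmett2006, Lemma (4.14)(b) (p. 72)] -/
theorem rcMeasureW_condWeights_real_mono_left {q : ℝ} (hq : 1 ≤ q) (B : Set V) {F F' : Set (Sym2 V)}
    (hF : F ⊆ F') {ξ : Set (Sym2 V)} (hξ : Disjoint ξ F') {A : Set (BondConfig V)} (hA : IsUpperSet A) :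
    (rcMeasureW (condWeights w F ξ) q B).real A ≤ (rcMeasureW (condWeights w F' ξ) q B).real A :=
  rcMeasureW_real_mono_weights (condWeights_mono_left_of_disjoint w hF hξ) hq B hA

/-- Positive association of every history-conditioned law (`q ≥ 1`): increasing events are positively correlated
(Grimmett 2006, Thm. (3.8) with (1.20); Lemma (4.14)(a)). [cite: Grimmett2006, Thm. (3.8); Lemma (4.14)(a)] -/
theorem rcMeasureW_condWeights_fkg {q : ℝ} (hq : 1 ≤ q) (B : Set V) (F ξ : Set (Sym2 V))
    {A A' : Set (BondConfig V)} (hA : IsUpperSet A) (hA' : IsUpperSet A') :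
    (rcMeasureW (condWeights w F ξ) q B).real A * (rcMeasureW (condWeights w F ξ) q B).real A' ≤
      (rcMeasureW (condWeights w F ξ) q B).real (A ∩ A') :=
  rcMeasureW_fkg (condWeights w F ξ) hq B hA hA'

end Monotonicity

end Summit.CriticalPhenomena.PercolationContinuityZ3.Theorems.FK

end
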